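import Literature.NumberTheory.EllipticCurves.ModularCurveNonempty
import Literature.NumberTheory.EllipticCurves.CaiShuTian2014.HeegnerConditionProofs
import HarnessLib

/-!
# An elliptic curve over `ℚ` that is multiplicative at `2` has an ODD bad prime (PROOFS ONLY — no `def`, no named fact)

Topic `NumberTheory/EllipticCurves`. Theorems only (no definition, no named fact, no instance, no notation, no `sorry`),
written by the seat `bsd-2adic-t42` of the cell `bsd-2adic` (HOME `run/shared/lean/pub/bsd-2adic/`, GEN 28).

The multiplicative congruence transport at `2` of that cell (Summits, `X5.O1.MultCongruenceTransportAtTwo`; Matsuno 2008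
Thm. 4.2 read at a multiplicative `2`) and all of its final doors display the side condition
`∃ ℓ ∈ (N_{E′} · N_E).primeFactors, ℓ ≠ 2` («`Σ₀` = the odd bad primes of the pair is non-empty», wanted by Matsuno's
Lemma 4.5 (i) as typed). For a curve `E` with MULTIPLICATIVE reduction at `2` this is automatic, granted the
Modularity theorem, and that is what this file proves:

* `ModularForms.conductorNorm_ne_two_of_modularity` — **no elliptic curve over `ℚ` has conductor `2`**: a globally
  minimal `W` carries a modular parametrisation datum at level `N_W` (`nonempty_modularParametrizationData`, BCDT), and
  level `2` is one of the fifteen genus-zero levels, where no datum exists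
  (`ModularParametrizationData_isEmpty_of_mem_genusZeroLevels`: `S₂(Γ₀(2)) = 0`, Diamond–Shurman Thm. 3.5.1 with
  Figure 3.3). (The tree's `eleven_le_conductorNorm_of_modularity` is the same argument for `N ≤ 10`; the present
  statement avoids that file's heavier analytic imports.)
* `ModularForms.exists_mem_primeFactors_conductorNorm_ne_two_of_hasMultiplicativeReductionAtPrime_two` — **if `E` is
  multiplicative at `2` then some odd prime divides `N_E`**: `ord₂(N_E) = f₂ = 1` (Silverman ATAEC IV.10.2 (b); tree
  `WeierstrassCurve.factorization_conductorNorm_eq_one_of_hasMultiplicativeReductionAtPrime`), so if `2` were the only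
  prime factor then `N_E = 2¹ = 2`, excluded by the first theorem.
* `ModularForms.exists_mem_primeFactors_mul_conductorNorm_ne_two_of_hasMultiplicativeReductionAtPrime_two` — the PAIR
  form displayed by the transport: some odd prime divides `N_{E′} · N_E`.

References: [BCDTJAMS2001] C. Breuil, B. Conrad, F. Diamond, R. Taylor, J. Amer. Math. Soc. 14 (2001), Thm. A;
[DiamondShurman2005] F. Diamond, J. Shurman, *A First Course in Modular Forms*, GTM 228, Thm. 3.1.1, Figure 3.3,
Thm. 3.5.1; [Silverman1994] J. H. Silverman, *ATAEC*, GTM 151, IV.10.2 (b); [Ogg1966] A. P. Ogg, *Abelian curves of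
2-power conductor*, Proc. Cambridge Philos. Soc. 62 (1966) 143–148 (the unconditional proof that no curve of conductor
`2` exists — not used here).
-/

set_option autoImplicit false

namespace Literature.NumberTheory.EllipticCurves.ModularForms

open _root_.WeierstrassCurve

/-- **No elliptic curve over `ℚ` has conductor `2` (granted modularity).** For a globally minimal elliptic `W/ℚ`,
`nonempty_modularParametrizationData` gives a modular parametrisation datum at level `N_W`; the level `2` has genus
`g(X₀(2)) = 0`, so `S₂(Γ₀(2)) = 0` carries no normalised newform and no datum exists
(`ModularParametrizationData_isEmpty_of_mem_genusZeroLevels`). [cite: BCDTJAMS2001, Thm. A]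
[cite: DiamondShurman2005, Thm. 3.5.1 with Figure 3.3] -/
theorem conductorNorm_ne_two_of_modularity (hmod : nonempty_modularParametrizationData)
    (W : WeierstrassCurve ℚ) [W.IsElliptic] [W.IsGloballyMinimal] : W.conductorNorm ℤ ≠ 2 := by
  intro h2
  haveI : NeZero (W.conductorNorm ℤ) := ⟨(conductorNorm_pos_holds W).ne'⟩
  obtain ⟨D⟩ := hmod W
  have hmem : W.conductorNorm ℤ ∈ ({1, 2, 3, 4, 5, 6, 7, 8, 9, 10, 12, 13, 16, 18, 25} : Finset ℕ) := by
    rw [h2]; decide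
  exact (ModularParametrizationData_isEmpty_of_mem_genusZeroLevels W _ hmem).false D

/-- **An elliptic curve over `ℚ` with multiplicative reduction at `2` has an odd bad prime (granted modularity):**
`∃ ℓ ∈ N_W.primeFactors, ℓ ≠ 2`. Indeed `ord₂(N_W) = f₂ = 1` at a multiplicative `2` (Silverman ATAEC IV.10.2 (b),
tree `factorization_conductorNorm_eq_one_of_hasMultiplicativeReductionAtPrime`); were `2` the only prime factor, the
factorisation of `N_W` would be `single 2 1`, i.e. `N_W = 2`, which `conductorNorm_ne_two_of_modularity` excludes.
[cite: Silverman1994, IV.10.2 (b)] [cite: BCDTJAMS2001, Thm. A] [cite: DiamondShurman2005, Thm. 3.5.1 with Figure 3.3] -/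
theorem exists_mem_primeFactors_conductorNorm_ne_two_of_hasMultiplicativeReductionAtPrime_two
    (hmod : nonempty_modularParametrizationData) (W : WeierstrassCurve ℚ) [W.IsElliptic] [W.IsGloballyMinimal]
    (hmult : W.HasMultiplicativeReductionAtPrime 2) :
    ∃ ℓ ∈ (W.conductorNorm ℤ).primeFactors, ℓ ≠ 2 := by
  by_contra h
  push Not at h
  have hN0 : W.conductorNorm ℤ ≠ 0 := (conductorNorm_pos_holds W).ne'
  have h1 : (W.conductorNorm ℤ).factorization 2 = 1 :=
    W.factorization_conductorNorm_eq_one_of_hasMultiplicativeReductionAtPrime 2 hmult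
  have hsupp : (W.conductorNorm ℤ).factorization.support ⊆ {2} := fun ℓ hℓ ↦
    Finset.mem_singleton.2 (h ℓ (Nat.support_factorization (W.conductorNorm ℤ) ▸ hℓ))
  have hsingle : (W.conductorNorm ℤ).factorization = Finsupp.single 2 1 := by
    rw [← h1]; exact Finsupp.support_subset_singleton.mp hsupp
  exact conductorNorm_ne_two_of_modularity hmod W
    ((Nat.eq_pow_of_factorization_eq_single hN0 hsingle).trans (pow_one 2))

/-- **Pair form (the side condition displayed by the multiplicative congruence transport at `2`):** if `W` is
multiplicative at `2` then some odd prime divides `N_{W′} · N_W`, for every elliptic `W′/ℚ` (granted modularity).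
[cite: Silverman1994, IV.10.2 (b)] [cite: BCDTJAMS2001, Thm. A] [cite: DiamondShurman2005, Thm. 3.5.1 with Figure 3.3] -/
theorem exists_mem_primeFactors_mul_conductorNorm_ne_two_of_hasMultiplicativeReductionAtPrime_two
    (hmod : nonempty_modularParametrizationData) (W' : WeierstrassCurve ℚ) [W'.IsElliptic]
    (W : WeierstrassCurve ℚ) [W.IsElliptic] [W.IsGloballyMinimal] (hmult : W.HasMultiplicativeReductionAtPrime 2) :
    ∃ ℓ ∈ (W'.conductorNorm ℤ * W.conductorNorm ℤ).primeFactors, ℓ ≠ 2 := by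
  obtain ⟨ℓ, hℓ, hℓ2⟩ :=
    exists_mem_primeFactors_conductorNorm_ne_two_of_hasMultiplicativeReductionAtPrime_two hmod W hmult
  exact ⟨ℓ, Nat.primeFactors_mono (dvd_mul_left _ _)
    (mul_ne_zero (conductorNorm_pos_holds W').ne' (conductorNorm_pos_holds W).ne') hℓ, hℓ2⟩

end Literature.NumberTheory.EllipticCurves.ModularForms
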